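import Mathlib
import HarnessLib
import Literature.AlgebraicGeometry.RelativeSpec.SymmetricPowerNormal
import Literature.AlgebraicGeometry.Resolution.ProjectiveSpaceRegular
import Literature.AlgebraicGeometry.Resolution.CompletedPullbackRegular

/-!
# The glued quotient `X/G` is regular when its chart rings are (crux stmt-ResolutionOfSingularities-15640, line `Sketch`)

Stub `stub_isRegular_glued` of the cyclic divisorial transfer (lead c8) for the crux
`WildQuotients.WildQuotientResolution`: the chart-to-global step of the regularity of the quotient
`V/G` (the tree's glued quotient `Literature.AlgebraicGeometry.RelativeSpec.ActionOver.glued`,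
SGA 1 V §1; Mumford, *Abelian Varieties*, §7). Every point `z` of `X/G` lies in a chart
`Spec Γ(O, r⁻¹U)^G ↪ O/G ↪ X/G` (`O` a `G`-stable open affine over the separated base `Y`,
`U ⊆ Y` an affine open around the image of `z`; `ActionOver.gluedι_jointly_surjective`,
`SubringDatum.fromSpec_preimage`), both arrows being open immersions, and the spectrum of a regular
ring is a regular scheme (`Resolution.Scheme.isRegular_Spec`); regularity of a scheme may be
checked on a jointly surjective family of open immersions
(`Resolution.Scheme.IsRegular.of_forall_exists_isOpenImmersion`).
-/

-- single-problem summit: the doubled namespace component `ResolutionOfSingularities` is forced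
set_option linter.dupNamespace false

noncomputable section

open CategoryTheory Limits AlgebraicGeometry TopologicalSpace
open Literature.AlgebraicGeometry.Resolution Literature.AlgebraicGeometry.RelativeSpec

namespace Summit.ResolutionOfSingularities.ResolutionOfSingularities.Theorems.WildQuotientResolution.CyclicTransfer

/-- **Every point of `X/G` lies in an affine chart `Spec Γ(O, r⁻¹U)^G ↪ O/G ↪ X/G`.** For an
action `ρ` of a finite group `G` on `X` over a separated base `Y` (`r : X → Y` separated) and a
point `z` of the glued quotient `ρ.glued`, there are a `G`-stable open `O ⊆ X` affine over `Y`, an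
affine open `U ⊆ Y` and a point `p` of `Spec Γ(O, (O ↪ X → Y)⁻¹U)^G` mapping to `z` under the
composite of the chart `Spec Γ(O, r⁻¹U)^G ↪ O/G` of the relative spectrum of the invariants
(`SubringDatum.openCover`) and the chart `O/G ↪ X/G` of the gluing (`ActionOver.gluedι`).
[cite: SGA1, Exp. V, §1, Prop. 1.8] [cite: MumfordAV1970, §7 Thm. p. 66] -/
theorem exists_chart_apply_eq {X Y : Scheme.{0}} {r : X ⟶ Y} {G : Type} [Group G] [Finite G]
    (ρ : ActionOver r G) [Y.IsSeparated] [IsSeparated r] (z : ρ.glued) :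
    ∃ (O : ρ.StableAffineOpens) (U : Y.affineOpens)
      (p : ↥((ρ.restrict O.1 O.2.1).invariants.openCover.X U)),
      ((ρ.restrict O.1 O.2.1).invariants.openCover.f U ≫ ρ.gluedι O) p = z := by
  obtain ⟨O, q, rfl⟩ := ρ.gluedι_jointly_surjective z
  -- an affine open of the base around the image of `q`
  obtain ⟨U, hqU⟩ : ∃ U : Y.affineOpens,
      (ρ.restrict O.1 O.2.1).quotientToBase q ∈ (U : Y.Opens) := by
    obtain ⟨U, hU, hqU, -⟩ := exists_isAffineOpen_mem_and_subset (X := Y)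
      (x := (ρ.restrict O.1 O.2.1).quotientToBase q) (U := ⊤) (Opens.mem_top _)
    exact ⟨⟨U, hU⟩, hqU⟩
  -- `q` lies in the chart `Spec Γ(O, r⁻¹U)^G = quotientToBase⁻¹ U ↪ O/G`
  have hmem : q ∈ (ρ.restrict O.1 O.2.1).invariants.fromSpec ⁻¹ᵁ (U : Y.Opens) := hqU
  rw [(ρ.restrict O.1 O.2.1).invariants.fromSpec_preimage U] at hmem
  obtain ⟨p, hp⟩ := hmem
  exact ⟨O, U, p, by rw [Scheme.Hom.comp_apply, hp]⟩

/-- **The glued quotient is regular when its chart rings are.** For an action `ρ` of a finite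
group `G` on `X` over a separated base `Y` (`r : X → Y` separated), if every ring of invariants
`Γ(O, (O ↪ X → Y)⁻¹U)^G` (`O` a `G`-stable open affine over `Y`, `U ⊆ Y` affine open) is a
regular ring, then `X/G = ρ.glued` is a regular scheme: every point lies in a chart
`Spec Γ(O, r⁻¹U)^G ↪ O/G ↪ X/G` (`exists_chart_apply_eq`), an open immersion, and `Spec` of a
regular ring is regular (`Scheme.isRegular_Spec`), so regularity follows from
`Scheme.IsRegular.of_forall_exists_isOpenImmersion`. [cite: SGA1, Exp. V, §1, Prop. 1.8]
[cite: StacksProject, Tag 02IS] -/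
theorem stub_isRegular_glued {X Y : Scheme.{0}} {r : X ⟶ Y} {G : Type} [Group G] [Finite G]
    (ρ : ActionOver r G) [Y.IsSeparated] [IsSeparated r]
    (h : ∀ (O : ρ.StableAffineOpens) (U : Y.affineOpens),
      IsRegularRing ((ρ.restrict O.1 O.2.1).invariants.ring U.1)) :
    Scheme.IsRegular ρ.glued := by
  refine Scheme.IsRegular.of_forall_exists_isOpenImmersion fun z => ?_
  obtain ⟨O, U, p, hp⟩ := exists_chart_apply_eq ρ z
  haveI := h O U
  exact ⟨_, (ρ.restrict O.1 O.2.1).invariants.openCover.f U ≫ ρ.gluedι O, inferInstance, ⟨p, hp⟩,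
    Scheme.isRegular_Spec (.of ((ρ.restrict O.1 O.2.1).invariants.ring U.1))⟩

end Summit.ResolutionOfSingularities.ResolutionOfSingularities.Theorems.WildQuotientResolution.CyclicTransfer

end
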